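import Summits.Ventures.HodgeRepro2.Hypothesis

/-!
# HodgeRepro2 — Shimura's `Γ_N` is a subgroup (proved)

Blind re-derivation cell `pub-hodge-repro2`, seat p2 (file 10; imports `Hypothesis.lean`).

`shimuraLevel K H 𝔪 N` of `Hypothesis.lean` transcribes [Sh79] (4.14),
`Γ_N = {γ ∈ G_ℚ | det(γ) = 1, 𝔪γ = 𝔪, 𝔪(1 − γ) ⊂ N𝔪}`, as a SET.  Here it is shown to be the
carrier of a subgroup `shimuraLevelSubgroup K H 𝔪 N` of `GL_m(K)`, so that the quantification
"a subgroup `Γ` of `Γ₁` of finite index" in `NonVanishingInput` (through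
`IsFiniteIndexSubgroupOf`) is about a genuine subgroup `Γ₁` (no vacuity).

[Sh79] G. Shimura, J. Math. Soc. Japan 31 (1979) 561–592, (4.14) p. 576.
-/

namespace Summit.Ventures.HodgeRepro2.ShimuraData

open NumberField Matrix

section Level

variable (K : Type*) [Field K] [NumberField K] [IsCMField K] {m : ℕ}

/-- [Sh79] (4.14) as a subgroup of `GL_m(K)`: carrier `shimuraLevel K H 𝔪 N`. -/
def shimuraLevelSubgroup (H : Matrix (Fin m) (Fin m) K) (𝔪 : Submodule ℤ (Fin m → K)) (N : ℕ) :
    Subgroup (GL (Fin m) K) where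
  carrier := shimuraLevel K H 𝔪 N
  one_mem' := by
    refine ⟨Subgroup.one_mem _, ?_, ?_, ?_⟩
    · intro x hx; simpa using hx
    · intro x hx; simpa using hx
    · intro x hx
      exact ⟨0, Submodule.zero_mem _, by simp⟩
  mul_mem' := by
    rintro a b ⟨ha1, ha2, ha3, ha4⟩ ⟨hb1, hb2, hb3, hb4⟩
    refine ⟨Subgroup.mul_mem _ ha1 hb1, ?_, ?_, ?_⟩
    · intro x hx
      rw [Units.val_mul, ← Matrix.vecMul_vecMul]
      exact hb2 _ (ha2 x hx)
    · intro x hx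
      rw [_root_.mul_inv_rev, Units.val_mul, ← Matrix.vecMul_vecMul]
      exact ha3 _ (hb3 x hx)
    · intro x hx
      obtain ⟨y, hy, hxy⟩ := ha4 x hx
      obtain ⟨z, hz, hxz⟩ := hb4 (Matrix.vecMul x (a : Matrix (Fin m) (Fin m) K)) (ha2 x hx)
      refine ⟨y + z, Submodule.add_mem _ hy hz, ?_⟩
      rw [Units.val_mul, ← Matrix.vecMul_vecMul, smul_add, ← hxy, ← hxz]
      abel
  inv_mem' := by
    rintro a ⟨ha1, ha2, ha3, ha4⟩
    refine ⟨Subgroup.inv_mem _ ha1, ha3, ?_, ?_⟩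
    · intro x hx
      rw [inv_inv]
      exact ha2 x hx
    · intro x hx
      -- `x(1 - a⁻¹) = -(x a⁻¹)(1 - a)`
      obtain ⟨y, hy, hxy⟩ := ha4 (Matrix.vecMul x ((a⁻¹ : GL (Fin m) K) : Matrix (Fin m) (Fin m) K))
        (ha3 x hx)
      refine ⟨-y, Submodule.neg_mem _ hy, ?_⟩
      have hinv : Matrix.vecMul (Matrix.vecMul x ((a⁻¹ : GL (Fin m) K) : Matrix (Fin m) (Fin m) K))
          (a : Matrix (Fin m) (Fin m) K) = x := by
        rw [Matrix.vecMul_vecMul, ← Units.val_mul, inv_mul_cancel, Units.val_one,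
          Matrix.vecMul_one]
      rw [hinv] at hxy
      rw [smul_neg, ← hxy]
      abel

/-- The carrier of `shimuraLevelSubgroup` is `shimuraLevel` (by definition). -/
theorem coe_shimuraLevelSubgroup (H : Matrix (Fin m) (Fin m) K) (𝔪 : Submodule ℤ (Fin m → K))
    (N : ℕ) : (shimuraLevelSubgroup K H 𝔪 N : Set (GL (Fin m) K)) = shimuraLevel K H 𝔪 N := rfl

/-- Consequently `IsFiniteIndexSubgroupOf K Γ (shimuraLevel K H 𝔪 N)` holds for every subgroup
`Γ` of finite index in `shimuraLevelSubgroup K H 𝔪 N` — e.g. for `Γ = Γ₁` itself. -/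
theorem isFiniteIndexSubgroupOf_shimuraLevel_self (H : Matrix (Fin m) (Fin m) K)
    (𝔪 : Submodule ℤ (Fin m → K)) (N : ℕ) :
    IsFiniteIndexSubgroupOf K (shimuraLevel K H 𝔪 N) (shimuraLevel K H 𝔪 N) :=
  ⟨shimuraLevelSubgroup K H 𝔪 N, shimuraLevelSubgroup K H 𝔪 N, rfl, rfl, le_rfl, by
    rw [Subgroup.subgroupOf_self]; infer_instance⟩

end Level

end Summit.Ventures.HodgeRepro2.ShimuraData
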